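import Summits.CriticalPhenomena.CardyFormulaZ2.Theorems.CardySelfDualSegmentUniformBoxCrossingDefs2
import Literature.Probability.Percolation.LowestCrossingInterface
import HarnessLib

/-!
# Stub `stub_link` (crux stmt-CriticalPhenomena-5476 `UniformBoxCrossing`, line `Sketch`), part 1:
# the interface lemma of the lower hull

Support file of the registered stub `stub_link` (`…UniformBoxCrossingStubLink.lean`): the
deterministic heart of Bollobás–Riordan's proof of Thm. 5.3 (arXiv:1001.4674, §5.1, p. 22–23:
"the minimal subpath `P'` of `P + X` meeting `A` and `B` … is present in `ω` and joins `P₁` and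
`P₂`, and `ω ∈ J`"), for the corner models, in the vocabulary of
`…UniformBoxCrossingDefs.lean` / `…UniformBoxCrossingDefs2.lean`.

This part is pure hull geometry of the square `[0, n]²` on `H([0, n]²)` (no top face explored):

* `exists_isBdryEdge_of_exit` — **the interface lemma at the `P₁` end, combinatorial half**: if
  a lattice step `a → u` of the strip `[0, n] × ℤ` leaves the lower region `A` (`a ∈ A`,
  `u ∉ A`), then some lattice edge at `a` is a boundary edge of the lower hull (a case analysis
  over the four faces around `a` and the four directions of the step).
* `mem_edges_of_isBdryEdge_link` — **winding half**: given the conclusion of the winding-number bridge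
  (`BridgeStatement`: the extended interface walk winds `-1` around the hull faces and `0` around
  the other faces of the dual square), every boundary edge of the hull is an edge of the
  interface walk (the winding number is constant across lattice edges off the walk,
  `walkWinding_eq_walkWinding_right/up`); hence `mem_support_of_exit`: `a` lies on the interface
  walk.
* `LinkInterfaceStatement` / `linkInterface_holds` — the registered glue of this file.

## References

* B. Bollobás, O. Riordan, *Percolation on self-dual polygon configurations*, Bolyai Soc. Math.
  Stud. 21 (2010) 131–217, arXiv:1001.4674, §5.1 proof of Thm. 5.3. [BollobasRiordan2010]
* H. Kesten, *Percolation theory for mathematicians*, Birkhäuser (1982), §2.2–2.3.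
  [KestenPTM1982]
-/

noncomputable section

namespace Summit.CriticalPhenomena.CardyFormulaZ2.Cruxes.UniformBoxCrossing.NonSlantLine

open SimpleGraph Finset Literature.Probability.Percolation Literature.Probability.LatticeModels

variable {n s : ℕ}

/-! ### Faces around a vertex, in coordinates -/

/-- A face with prescribed coordinates relative to `v` is one of the four faces around `v`. [folklore] -/
theorem mem_facesAt_of_apply {v g : Site 2} (h0 : g 0 = v 0 ∨ g 0 + 1 = v 0)
    (h1 : g 1 = v 1 ∨ g 1 + 1 = v 1) : g ∈ facesAt v := by
  rw [mem_facesAt_iff]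
  simp only [Site.eq_iff_two, Pi.sub_apply, single_zero_apply_zero, single_zero_apply_one,
    single_one_apply_zero, single_one_apply_one]
  omega

/-- Coordinates of the four faces around `v`. [folklore] -/
theorem apply_of_mem_facesAt {v g : Site 2} (h : g ∈ facesAt v) :
    (g 0 = v 0 ∨ g 0 + 1 = v 0) ∧ (g 1 = v 1 ∨ g 1 + 1 = v 1) := by
  rw [mem_facesAt_iff] at h
  simp only [Site.eq_iff_two, Pi.sub_apply, single_zero_apply_zero, single_zero_apply_one,
    single_one_apply_zero, single_one_apply_one] at h
  omega

/-- The face reflection `reflY (c - 1)` carries the faces around `z` to the faces around the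
reflected vertex `reflY c z`. [folklore] -/
theorem reflY_pred_mem_facesAt_link {c : ℤ} {z g : Site 2} (hg : g ∈ facesAt z) :
    reflY (c - 1) g ∈ facesAt (reflY c z) := by
  obtain ⟨h0, h1⟩ := apply_of_mem_facesAt hg
  apply mem_facesAt_of_apply
  · rw [reflY_apply_zero, reflY_apply_zero]; exact h0
  · rw [reflY_apply_one, reflY_apply_one]; omega

/-! ### Coordinates of hull faces and of the two regions -/

/-- The lower hull lies in the dual square. [folklore] -/
theorem lowerHull_subset_dualRectangle (n : ℕ) (ω : BondConfig (Site 2)) :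
    lowerHull n ω ⊆ dualRectangle n n := fun _ h => ((mem_lowerHull_iff n).1 h).1

/-- On `H([0,n]²)` (no top face explored) no top face lies in the hull. [folklore] -/
theorem not_mem_lowerHull_of_mem_dualTopSide_link {ω : BondConfig (Site 2)}
    (htop : ∀ f ∈ dualTopSide n n, f ∉ dualBelow n ω) {f : Site 2} (hf : f ∈ dualTopSide n n) :
    f ∉ lowerHull n ω := fun hfH =>
  ((mem_lowerHull_iff n).1 hfH).2 ⟨f, hf, f, rfl, openConnIn_refl
    ⟨Finset.mem_coe.2 (Finset.mem_filter.1 hf).1, htop f hf⟩⟩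

/-- Coordinates of the hull faces on `H([0,n]²)`: columns `0 … n - 1`, rows `-1 … n - 1`. [folklore] -/
theorem lowerHull_bounds_link {ω : BondConfig (Site 2)} (htop : ∀ f ∈ dualTopSide n n, f ∉ dualBelow n ω)
    {g : Site 2} (hg : g ∈ lowerHull n ω) : 0 ≤ g 0 ∧ g 0 + 1 ≤ n ∧ -1 ≤ g 1 ∧ g 1 + 1 ≤ n := by
  have hgR := mem_dualRectangle_iff.1 (lowerHull_subset_dualRectangle n ω hg)
  have hne : g 1 ≠ n := fun h1 =>
    not_mem_lowerHull_of_mem_dualTopSide_link htop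
      (by simp only [dualTopSide, Finset.mem_filter]; exact ⟨lowerHull_subset_dualRectangle n ω hg, h1⟩) hg
  omega

/-- The bottom faces of the dual square lie in the hull. [folklore] -/
theorem mem_lowerHull_of_bottom {ω : BondConfig (Site 2)} {g : Site 2} (h0 : 0 ≤ g 0) (h0' : g 0 + 1 ≤ n)
    (h1 : g 1 = -1) : g ∈ lowerHull n ω :=
  dualBelow_subset_lowerHull n ω (mem_dualBelow_of_mem_dualBottomSide (by
    simp only [dualBottomSide, Finset.mem_filter, mem_dualRectangle_iff]
    omega))

/-- Points of the lower region have height at most `n + 1`. [folklore] -/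
theorem apply_one_le_of_mem_lowerRegion_link {ω : BondConfig (Site 2)} {v : Site 2}
    (hv : v ∈ lowerRegion n ω) : v 1 ≤ n + 1 := by
  rcases hv with hv | ⟨g, hg, hgH⟩
  · omega
  · have hgR := mem_dualRectangle_iff.1 (lowerHull_subset_dualRectangle n ω hgH)
    have := apply_of_mem_facesAt hg
    omega

/-- A point of the lower region at nonnegative height is a corner of a hull face: its column is
in `[0, n]` and its height is at most `n + 1`. [folklore] -/
theorem bounds_of_mem_lowerRegion {ω : BondConfig (Site 2)} {v : Site 2} (hv : v ∈ lowerRegion n ω)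
    (hv1 : 0 ≤ v 1) : 0 ≤ v 0 ∧ v 0 ≤ n ∧ v 1 ≤ n + 1 := by
  rcases hv with hv | ⟨g, hg, hgH⟩
  · omega
  · have hgR := mem_dualRectangle_iff.1 (lowerHull_subset_dualRectangle n ω hgH)
    have := apply_of_mem_facesAt hg
    omega

/-- Points of the upper region have height at least `s - 1`. [folklore] -/
theorem le_apply_one_of_mem_upperRegion {ω : BondConfig (Site 2)} {v : Site 2}
    (hv : v ∈ upperRegion n s ω) : (s : ℤ) - 1 ≤ v 1 := by
  have h := apply_one_le_of_mem_lowerRegion_link ((mem_upperRegion_iff n s).1 hv)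
  rw [upperRefl_apply_one] at h
  omega

/-! ### The interface lemma: a step leaving the lower region crosses the interface walk -/

/-- **The interface lemma at the `P₁` end, combinatorial half.** On `H([0,n]²)`, if `a` lies in
the lower region `A`, its lattice neighbour `u` (in a column of `[0, n]`) does not, then some
lattice edge at `a` is a boundary edge of the lower hull: around `a` there is a hull face, the
faces at the edge `{a, u}` are faces around `u` and hence not hull faces, and going around `a`
one crosses from a hull face to a non-hull face of the dual square across an edge at `a`.
[cite: BollobasRiordan2010, §5.1 proof of Thm. 5.3] -/
theorem exists_isBdryEdge_of_exit {ω : BondConfig (Site 2)} (hn : 1 ≤ n)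
    (htop : ∀ f ∈ dualTopSide n n, f ∉ dualBelow n ω) {a u : Site 2}
    (ha : a ∈ lowerRegion n ω) (hu : u ∉ lowerRegion n ω) (hadj : (zdGraph 2).Adj a u)
    (hu0 : 0 ≤ u 0) (hu0' : u 0 ≤ n) :
    ∃ e ∈ (zdGraph 2).edgeSet, a ∈ e ∧ IsBdryEdge (lowerHull n ω) n e := by
  rw [mem_lowerRegion_iff] at hu
  push Not at hu
  obtain ⟨hu1, huf⟩ := hu
  have hHb : ∀ g ∈ lowerHull n ω, 0 ≤ g 0 ∧ g 0 + 1 ≤ n ∧ -1 ≤ g 1 ∧ g 1 + 1 ≤ n :=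
    fun g hg => lowerHull_bounds_link htop hg
  -- packaging of the conclusion
  have conclude : ∀ (e : Sym2 (Site 2)) (g g' : Site 2), e ∈ (zdGraph 2).edgeSet → a ∈ e →
      dualEdge e = s(g, g') → g ∈ lowerHull n ω → g' ∉ lowerHull n ω →
      (0 ≤ g' 0 ∧ g' 0 + 1 ≤ n ∧ -1 ≤ g' 1 ∧ g' 1 ≤ n) →
      ∃ e ∈ (zdGraph 2).edgeSet, a ∈ e ∧ IsBdryEdge (lowerHull n ω) n e :=
    fun e g g' he hae hde hg hg' hb => ⟨e, he, hae, g, g', hde,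
      lowerHull_subset_dualRectangle n ω hg,
      mem_dualRectangle_iff.2 ⟨hb.1, by omega, hb.2.2.1, hb.2.2.2⟩, hg, hg'⟩
  -- the four lattice edges at `a` and their dual edges
  have heN : s(a, a + Pi.single 1 1) ∈ (zdGraph 2).edgeSet := single_edge_mem a 1
  have heE : s(a, a + Pi.single 0 1) ∈ (zdGraph 2).edgeSet := single_edge_mem a 0
  have heS : s(a - Pi.single 1 1, a) ∈ (zdGraph 2).edgeSet := by
    have h := single_edge_mem (a - Pi.single 1 1) 1
    rwa [sub_add_cancel] at h
  have heW : s(a - Pi.single 0 1, a) ∈ (zdGraph 2).edgeSet := by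
    have h := single_edge_mem (a - Pi.single 0 1) 0
    rwa [sub_add_cancel] at h
  have hdN : dualEdge s(a, a + Pi.single 1 1) = s(a - Pi.single 0 1, a) := dualEdge_vertical a
  have hdE : dualEdge s(a, a + Pi.single 0 1) = s(a - Pi.single 1 1, a) := dualEdge_horizontal a
  have hdS : dualEdge s(a - Pi.single 1 1, a) =
      s(a - Pi.single 0 1 - Pi.single 1 1, a - Pi.single 1 1) := by
    have h := dualEdge_vertical (a - Pi.single 1 1)
    rwa [sub_add_cancel, sub_right_comm] at h
  have hdW : dualEdge s(a - Pi.single 0 1, a) =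
      s(a - Pi.single 0 1 - Pi.single 1 1, a - Pi.single 0 1) := by
    have h := dualEdge_horizontal (a - Pi.single 0 1)
    rwa [sub_add_cancel] at h
  have haN : a ∈ s(a, a + Pi.single 1 1) := Sym2.mem_mk_left _ _
  have haE : a ∈ s(a, a + Pi.single 0 1) := Sym2.mem_mk_left _ _
  have haS : a ∈ s(a - Pi.single 1 1, a) := Sym2.mem_mk_right _ _
  have haW : a ∈ s(a - Pi.single 0 1, a) := Sym2.mem_mk_right _ _
  -- case analysis on the direction of the step and on the hull face at `a`
  rcases stepKind_of_adj hadj with ⟨h0, h1⟩ | ⟨h0, h1⟩ | ⟨h1, h0⟩ | ⟨h1, h0⟩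
  · -- step to the right: the faces `a` and `a - e₁` are faces around `u`
    have hNE : a ∉ lowerHull n ω := huf _ (mem_facesAt_of_apply (by omega) (by omega))
    have hSE : a - Pi.single 1 1 ∉ lowerHull n ω := huf _ (mem_facesAt_of_apply
      (by simp only [Pi.sub_apply, single_one_apply_zero]; omega)
      (by simp only [Pi.sub_apply, single_one_apply_one]; omega))
    rcases ha with ha | ⟨g, hg, hgH⟩
    · omega
    rcases mem_facesAt_iff.1 hg with rfl | rfl | rfl | rfl
    · exact absurd hgH hNE
    · have hb := hHb _ hgH
      simp only [Pi.sub_apply, single_zero_apply_zero, single_zero_apply_one] at hb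
      exact conclude _ _ _ heN haN hdN hgH hNE (by omega)
    · exact absurd hgH hSE
    · have hb := hHb _ hgH
      simp only [Pi.sub_apply, single_zero_apply_zero, single_zero_apply_one,
        single_one_apply_zero, single_one_apply_one] at hb
      exact conclude _ _ _ heS haS hdS hgH hSE
        (by simp only [Pi.sub_apply, single_one_apply_zero, single_one_apply_one]; omega)
  · -- step to the left: the faces `a - e₀` and `a - e₀ - e₁` are faces around `u`
    have hNW : a - Pi.single 0 1 ∉ lowerHull n ω := huf _ (mem_facesAt_of_apply
      (by simp only [Pi.sub_apply, single_zero_apply_zero]; omega)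
      (by simp only [Pi.sub_apply, single_zero_apply_one]; omega))
    have hSW : a - Pi.single 0 1 - Pi.single 1 1 ∉ lowerHull n ω := huf _ (mem_facesAt_of_apply
      (by simp only [Pi.sub_apply, single_zero_apply_zero, single_one_apply_zero]; omega)
      (by simp only [Pi.sub_apply, single_zero_apply_one, single_one_apply_one]; omega))
    rcases ha with ha | ⟨g, hg, hgH⟩
    · omega
    rcases mem_facesAt_iff.1 hg with rfl | rfl | rfl | rfl
    · have hb := hHb _ hgH
      exact conclude _ _ _ heN haN (hdN.trans Sym2.eq_swap) hgH hNW
        (by simp only [Pi.sub_apply, single_zero_apply_zero, single_zero_apply_one]; omega)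
    · exact absurd hgH hNW
    · have hb := hHb _ hgH
      simp only [Pi.sub_apply, single_one_apply_zero, single_one_apply_one] at hb
      exact conclude _ _ _ heS haS (hdS.trans Sym2.eq_swap) hgH hSW
        (by simp only [Pi.sub_apply, single_zero_apply_zero, single_zero_apply_one,
          single_one_apply_zero, single_one_apply_one]; omega)
    · exact absurd hgH hSW
  · -- step upwards: the faces `a` and `a - e₀` are faces around `u`
    have hNE : a ∉ lowerHull n ω := huf _ (mem_facesAt_of_apply (by omega) (by omega))
    have hNW : a - Pi.single 0 1 ∉ lowerHull n ω := huf _ (mem_facesAt_of_apply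
      (by simp only [Pi.sub_apply, single_zero_apply_zero]; omega)
      (by simp only [Pi.sub_apply, single_zero_apply_one]; omega))
    rcases ha with ha | ⟨g, hg, hgH⟩
    · -- `a` is just below the square: one of the two bottom faces at `u` lies in the hull
      exfalso
      by_cases hc : a 0 + 1 ≤ n
      · exact hNE (mem_lowerHull_of_bottom (by omega) hc (by omega))
      · exact hNW (mem_lowerHull_of_bottom
          (by simp only [Pi.sub_apply, single_zero_apply_zero]; omega)
          (by simp only [Pi.sub_apply, single_zero_apply_zero]; omega)
          (by simp only [Pi.sub_apply, single_zero_apply_one]; omega))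
    rcases mem_facesAt_iff.1 hg with rfl | rfl | rfl | rfl
    · exact absurd hgH hNE
    · exact absurd hgH hNW
    · have hb := hHb _ hgH
      simp only [Pi.sub_apply, single_one_apply_zero, single_one_apply_one] at hb
      exact conclude _ _ _ heE haE hdE hgH hNE (by omega)
    · have hb := hHb _ hgH
      simp only [Pi.sub_apply, single_zero_apply_zero, single_zero_apply_one,
        single_one_apply_zero, single_one_apply_one] at hb
      exact conclude _ _ _ heW haW hdW hgH hNW
        (by simp only [Pi.sub_apply, single_zero_apply_zero, single_zero_apply_one]; omega)
  · -- step downwards: the faces `a - e₁` and `a - e₀ - e₁` are faces around `u`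
    have hSE : a - Pi.single 1 1 ∉ lowerHull n ω := huf _ (mem_facesAt_of_apply
      (by simp only [Pi.sub_apply, single_one_apply_zero]; omega)
      (by simp only [Pi.sub_apply, single_one_apply_one]; omega))
    have hSW : a - Pi.single 0 1 - Pi.single 1 1 ∉ lowerHull n ω := huf _ (mem_facesAt_of_apply
      (by simp only [Pi.sub_apply, single_zero_apply_zero, single_one_apply_zero]; omega)
      (by simp only [Pi.sub_apply, single_zero_apply_one, single_one_apply_one]; omega))
    rcases ha with ha | ⟨g, hg, hgH⟩
    · omega
    rcases mem_facesAt_iff.1 hg with rfl | rfl | rfl | rfl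
    · have hb := hHb _ hgH
      exact conclude _ _ _ heE haE (hdE.trans Sym2.eq_swap) hgH hSE
        (by simp only [Pi.sub_apply, single_one_apply_zero, single_one_apply_one]; omega)
    · have hb := hHb _ hgH
      simp only [Pi.sub_apply, single_zero_apply_zero, single_zero_apply_one] at hb
      exact conclude _ _ _ heW haW (hdW.trans Sym2.eq_swap) hgH hSW
        (by simp only [Pi.sub_apply, single_zero_apply_zero, single_zero_apply_one,
          single_one_apply_zero, single_one_apply_one]; omega)
    · exact absurd hgH hSE
    · exact absurd hgH hSW

/-- Edges of the extended walk `extendRight π 0` with both endpoints in columns `≤ n` are edges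
of the square crossing `π` itself (the extension lives on the column `n + 1`). [folklore] -/
theorem mem_edges_of_mem_edges_ext {w : XWalk} (hw : IsSquareCrossing n w.walk)
    {e : Sym2 (Site 2)} (he : e ∈ (extendRight w.walk 0).edges) (hcol : ∀ z ∈ e, z 0 ≤ n) :
    e ∈ w.walk.edges := by
  rcases mem_edges_extendRight he with h | ⟨z, hz, hz0⟩
  · exact h
  · have := hcol z hz
    rw [hw.finish] at hz0
    omega

/-- **The interface lemma, winding half.** If the extended interface walk winds `-1` around every
hull face and `0` around every other face of the dual square (the conclusion of
`BridgeStatement`), then every boundary edge of the hull is an edge of the interface walk: the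
winding number agrees across lattice edges off the walk. [cite: BollobasRiordan2010, §5.1 proof of Thm. 5.3] -/
theorem mem_edges_of_isBdryEdge_link {ω : BondConfig (Site 2)} {w : XWalk} (hw : IsSquareCrossing n w.walk)
    (hW₁ : ∀ f ∈ lowerHull n ω, walkWinding (extendRight w.walk 0) f = -1)
    (hW₀ : ∀ f ∈ dualRectangle n n, f ∉ lowerHull n ω → walkWinding (extendRight w.walk 0) f = 0)
    {e : Sym2 (Site 2)} (he : e ∈ (zdGraph 2).edgeSet) (hb : IsBdryEdge (lowerHull n ω) n e) :
    e ∈ w.walk.edges := by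
  obtain ⟨g, g', hde, hgR, hg'R, hgH, hg'H⟩ := hb
  have hWg : walkWinding (extendRight w.walk 0) g = -1 := hW₁ g hgH
  have hWg' : walkWinding (extendRight w.walk 0) g' = 0 := hW₀ g' hg'R hg'H
  rw [mem_dualRectangle_iff] at hgR hg'R
  by_contra hne
  obtain ⟨x, hi⟩ := mem_edgeSet_zdGraph_iff.1 he
  rcases Fin.exists_fin_two.1 hi with rfl | rfl
  · -- a horizontal edge `{x, x + e₀}`: its faces are `x - e₁` and `x`
    rw [dualEdge_horizontal] at hde
    have hx : 0 ≤ x 0 ∧ x 0 + 1 ≤ n ∧ -1 ≤ x 1 := by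
      rcases Sym2.eq_iff.1 hde with ⟨-, rfl⟩ | ⟨-, rfl⟩ <;> omega
    have hne' : s(x, x + Pi.single 0 1) ∉ (extendRight w.walk 0).edges := fun h =>
      hne (mem_edges_of_mem_edges_ext hw h (fun z hz => by
        rcases Sym2.mem_iff.1 hz with rfl | rfl
        · omega
        · simp only [Pi.add_apply, single_zero_apply_zero]; omega))
    have key := walkWinding_eq_walkWinding_up (p := extendRight w.walk 0) (u := x - Pi.single 1 1)
      (by rw [sub_add_cancel]; exact hne')
      (hw.start_notMem_rayAbove' (by simp only [Pi.sub_apply, single_one_apply_zero]; omega))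
      (hw.ext_end_notMem_rayAbove (by simp only [Pi.sub_apply, single_one_apply_one]; omega))
    rw [sub_add_cancel] at key
    rcases Sym2.eq_iff.1 hde with ⟨h1, h2⟩ | ⟨h1, h2⟩
    · rw [h1, h2] at key; omega
    · rw [h1, h2] at key; omega
  · -- a vertical edge `{x, x + e₁}`: its faces are `x - e₀` and `x`
    rw [dualEdge_vertical] at hde
    have hx : 0 ≤ x 0 ∧ x 0 + 1 ≤ n ∧ -1 ≤ x 1 := by
      rcases Sym2.eq_iff.1 hde with ⟨-, rfl⟩ | ⟨-, rfl⟩ <;> omega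
    have hne' : s(x, x + Pi.single 1 1) ∉ (extendRight w.walk 0).edges := fun h =>
      hne (mem_edges_of_mem_edges_ext hw h (fun z hz => by
        rcases Sym2.mem_iff.1 hz with rfl | rfl
        · omega
        · simp only [Pi.add_apply, single_one_apply_zero]; omega))
    have key := walkWinding_eq_walkWinding_right (p := extendRight w.walk 0) (u := x - Pi.single 0 1)
      (by rw [sub_add_cancel]; exact hne')
    rw [sub_add_cancel] at key
    rcases Sym2.eq_iff.1 hde with ⟨h1, h2⟩ | ⟨h1, h2⟩
    · rw [h1, h2] at key; omega
    · rw [h1, h2] at key; omega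

/-- **The interface lemma at the `P₁` end** (Bollobás–Riordan: the minimal sub-path of `P + X`
from `A` to `B` starts ON the lowest crossing `P₁`): on `H([0,n]²)`, for an interface walk `w` of
the lower hull and a lattice step `a → u` of the strip leaving the lower region at `a`, the vertex
`a` lies on `w`. [cite: BollobasRiordan2010, §5.1 proof of Thm. 5.3] -/
theorem mem_support_of_exit (hbridge : BridgeStatement) {ω : BondConfig (Site 2)}
    (hω : ω ⊆ (zdGraph 2).edgeSet) (hn : 1 ≤ n) (htop : ∀ f ∈ dualTopSide n n, f ∉ dualBelow n ω)
    {w : XWalk} (hw : IsSquareCrossing n w.walk)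
    (hwd : ∀ d ∈ w.walk.darts, IsBdryEdge (lowerHull n ω) n d.edge) {a u : Site 2}
    (ha : a ∈ lowerRegion n ω) (hu : u ∉ lowerRegion n ω) (hadj : (zdGraph 2).Adj a u)
    (hu0 : 0 ≤ u 0) (hu0' : u 0 ≤ n) : a ∈ w.walk.support := by
  obtain ⟨hW₁, hW₀⟩ := hbridge n ω hω htop w hw hwd
  obtain ⟨e, he, hae, hb⟩ := exists_isBdryEdge_of_exit hn htop ha hu hadj hu0 hu0'
  exact Walk.mem_support_of_mem_edges (mem_edges_of_isBdryEdge_link hw hW₁ hW₀ he hb) hae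

/-- Interface walks are open: their darts are boundary edges of the explored set. [folklore] -/
theorem isOpen_of_interfaceWalk {ω : BondConfig (Site 2)} {w : XWalk}
    (hwd : ∀ d ∈ w.walk.darts, IsBdryEdge (lowerHull n ω) n d.edge) :
    ∀ e ∈ w.walk.edges, e ∈ ω := by
  intro e he
  rw [Walk.edges] at he
  obtain ⟨d, hd, rfl⟩ := List.mem_map.1 he
  exact mem_of_isBdryEdge rfl d.edge_mem
    (isBdryEdge_dualBelow_of_isBdryEdge_lowerHull n d.edge_mem (hwd d hd))

/-! ### Registered glue -/

/-- Statement form of `exists_isBdryEdge_of_exit` — the interface lemma of the lower hull (a step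
of the strip leaving the lower region crosses a hull-boundary edge at its start): a registered
glue step the LINE POSITS and proves right below (`linkInterface_holds`); not a literature fact,
never to be relocated. -/
def LinkInterfaceStatement : Prop :=
  ∀ (n : ℕ) (ω : BondConfig (Site 2)) (a u : Site 2), 1 ≤ n →
    (∀ f ∈ dualTopSide n n, f ∉ dualBelow n ω) →
    a ∈ lowerRegion n ω → u ∉ lowerRegion n ω → (zdGraph 2).Adj a u → 0 ≤ u 0 → u 0 ≤ n →
    ∃ e ∈ (zdGraph 2).edgeSet, a ∈ e ∧ IsBdryEdge (lowerHull n ω) n e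

/-- The interface lemma of the lower hull holds. [cite: BollobasRiordan2010, §5.1 proof of Thm. 5.3] -/
theorem linkInterface_holds : LinkInterfaceStatement :=
  fun _ _ _ _ hn htop ha hu hadj hu0 hu0' => exists_isBdryEdge_of_exit hn htop ha hu hadj hu0 hu0'

end Summit.CriticalPhenomena.CardyFormulaZ2.Cruxes.UniformBoxCrossing.NonSlantLine
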